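import Mathlib
import HarnessLib
import HarnessLib.Audit
import Summits.CriticalPhenomena.Statement
import Literature.Probability.Percolation.BondPercolationSymmetry

/-!
Route: PercPotemkinWeaver

# Route PercPotemkinWeaver — Potemkin weaver dichotomy — a finite-energy weaving measure on Z^3
exists, or FKG half-space rigidity proves theta(p_c)=0

It suffices to show X = FKG HALF-SPACE RIGIDITY: every probability measure μ on bond configurations
of ℤ³ that is
translation-invariant, ergodic under every non-zero translation, invariant under all lattice
automorphisms, insertion- AND
deletion-tolerant (finite energy), positively associated, and whose clusters restricted to every
coordinate half-space
{x_i ≥ a} / {x_i ≤ a} are a.s. all finite, satisfies μ(|C(0)| = ∞) = 0. Bernoulli(p_c) on ℤ³ has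
every hypothesis
(BarskyGrimmettNewman1991 = Grimmett1999 Thm (7.35), PROVED in tree as
BarskyGrimmettNewman1991_Z3_holds; Harris;
ergodicity of Bernoulli shifts; 0 < p_c < 1), so X → θ(p_c) = 0 (support item BernoulliSoftPortrait
+ Assembly, pure logic).
The route realises the NEGATIVE-SIDE card CriticalPhenomena/PercolationContinuityZ3/potemkin-weaver
as a typed dichotomy:
its ranked cruxes are the POTEMKIN WEAVERS — explicit stationary finite-energy measures on ℤ³ with a
(necessarily unique,
Burton–Keane in tree) dense infinite cluster finite in every half-space — whose existence (cruxes
PotemkinWeaverExists,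
ErgodicWeaverExists, expected TRUE) proves that stationarity + ergodicity + finite energy +
uniqueness + mass transport +
BGN/DST half-space/slab finiteness cannot by themselves give θ(p_c) = 0, and bounds X from below: ¬X
is exactly an FKG
weaver (Sketch.lean: ¬FKGHalfSpaceRigidity → PotemkinWeaverExists → ErgodicWeaverExists, proved).
Either X is refuted
(barrier complete up to positive association: positive routes must use independence quantitatively)
or X is proved
(and with it the conjunct).
Lean: `∀ μ : MeasureTheory.Measure (Literature.Probability.Percolation.BondConfig
(Literature.Probability.LatticeModels.Site 3)), MeasureTheory.IsProbabilityMeasure μ →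
Literature.Probability.Percolation.IsInsertionTolerantErgodic μ → (∀ N : ℕ, ∃ c : ℝ, 0 < c ∧ ∀ S :
Set (Literature.Probability.Percolation.BondConfig (Literature.Probability.LatticeModels.Site 3)),
MeasurableSet S → c * μ.real ((fun ω : Literature.Probability.Percolation.BondConfig
(Literature.Probability.LatticeModels.Site 3) => ω \ ↑(Literature.Probability.LatticeModels.edgesIn
(Literature.Probability.LatticeModels.zdGraph 3) (Literature.Probability.LatticeModels.box 3 N)))
⁻¹' S) ≤ μ.real S) → (∀ v : Literature.Probability.LatticeModels.Site 3, v ≠ 0 → Ergodic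
(Literature.Probability.Percolation.BondConfig.relabel (Literature.Probability.Percolation.sym2Equiv
(Literature.Probability.LatticeModels.Site.shift v))) μ) → (∀ (γ :
Literature.Probability.LatticeModels.zdGraph 3 ≃g Literature.Probability.LatticeModels.zdGraph 3) (A
: Set (Literature.Probability.Percolation.BondConfig (Literature.Probability.LatticeModels.Site
3))), MeasurableSet A → μ (Literature.Probability.Percolation.BondConfig.relabel
(Literature.Probability.Percolation.sym2Equiv γ.toEquiv) ⁻¹' A) = μ A) → (∀ A B : Set
(Literature.Probability.Percolation.BondConfig (Literature.Probability.LatticeModels.Site 3)),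
IsUpperSet A → IsUpperSet B → MeasurableSet A → MeasurableSet B → μ A * μ B ≤ μ (A ∩ B)) → (∀ᵐ ω ∂μ,
∀ (i : Fin 3) (a : ℤ) (v : Literature.Probability.LatticeModels.Site 3), {y :
Literature.Probability.LatticeModels.Site 3 | ω ∈ Literature.Probability.Percolation.openConnIn {x :
Literature.Probability.LatticeModels.Site 3 | a ≤ x i} v y}.Finite ∧ {y :
Literature.Probability.LatticeModels.Site 3 | ω ∈ Literature.Probability.Percolation.openConnIn {x :
Literature.Probability.LatticeModels.Site 3 | x i ≤ a} v y}.Finite) → μ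
(Literature.Probability.Percolation.percolatesAt (0 : Literature.Probability.LatticeModels.Site 3))
= 0`

## Assembly
Pure logic (proved in the planner's Sketch.lean, `assembly_provable`): PercolationContinuityZ3
unfolds to
theta (zdGraph 3) 0 (criticalProbI 3) = (P_{p_c}).real (percolatesAt 0) = 0; feed the six components
of BernoulliSoftPortrait
(and the IsProbabilityMeasure instance of bondPercolation) to FKGHalfSpaceRigidity to get
P_{p_c}(percolatesAt 0) = 0, then
measureReal_def / ENNReal.toReal_zero. The existence cruxes are the negative side of the dichotomy
and are deliberately not
antecedents: ¬FKGHalfSpaceRigidity → PotemkinWeaverExists → ErgodicWeaverExists (Sketch.lean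
`weaver_of_not_rigidity`,
`ergodicWeaver_of_potemkin`), so each weaver proved narrows what a proof of X may use, and a
refutation of either weaver
statement is a rigidity theorem that proves X a fortiori.

Rationale: WHY THIS LINE. Grimmett1999 p.163 calls the jump world at p_c(ℤ³) — a unique infinite cluster "a.s.
partitioned into (only) finite
clusters by any division of ℤ^d into two half-spaces" — striking but leaves it standing; eight
positive routes of this
sub attack it with Bernoulli tools, none asks whether the SOFT portrait is already contradictory.
Invariant-percolation
theory says how to decide that: build the monster (HaggstromMester2009 Thm 1.2 built
translation-invariant UNIFORMLY
finite-energy coexistence measures on ℤ²; BenjaminiHaggstromSchramm2000 / BenjaminiTassion2017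
Question 1 show
'invariant + finite energy + percolating + p_c(X)=1' is open and that sprinkled dense skeletons
percolate in half-spaces,
Thm 1(3) + Remark (a) — the obstruction every weaver design must dodge; AngelHutchcroft2018 do the
analogue on unimodular
random graphs; in-house card ust-hull-potemkin shows the uniform spanning tree of ℤ³ already
realises the rung WITHOUT
finite energy). Imported area: ergodic theory / probability on groups (mass transport, Burton–Keane
for insertion-tolerant
ergodic measures — ae_numInfiniteClusters_le_one_of_isInsertionTolerantErgodic in tree —
factor-of-iid and odometer
stationarisation), plus hierarchical moat/tube constructions (ChayesChayesDurrett1987-style summable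
failure across scales).
What it does that prior routes and the negatives index do not: it is the first negative-side route
of the sub; its
positive crux X is NOT the same-p transfer of the closed PercHalfSpace (≡ conjunct) but a
universally quantified
sufficient condition with a provable assembly resting only on proved cone facts; and it fixes a
loophole of the card —
random-offset (odometer) hierarchies are not ergodic under a single translation, so they would not
block Grimmett's
'invariant under shifts (i,j,0) ⇒ probability 0 or 1' step (Grimmett1999 p.165):
PotemkinWeaverExists demands ergodicity
under EVERY non-zero translation.

RANKED CRUXES. #2 PotemkinWeaverExists (crux) — there is a probability measure μ on bond
configurations of ℤ³ which is translation-invariant, ℤ³-ergodic and insertion-tolerant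
(IsInsertionTolerantErgodic μ, hence a.s. unique infinite cluster by the in-tree Burton–Keane
theorem), deletion-tolerant (closing the edges of any box costs at most a factor), ergodic under
every single non-zero translation, percolating (μ(|C(0)| = ∞) > 0), and such that a.s. every cluster
of the configuration restricted to every half-space {a ≤ x_i} and {x_i ≤ a} is finite (card
potemkin-weaver Crux 1, strengthened by total ergodicity; slabs follow from half-spaces).
[difficulty: XL] (why it might fail: May be FALSE: total ergodicity + finite energy + half-space
finiteness might force θ=0 (that proof + BernoulliSoftPortrait gives the conjunct). Design traps:
BT2017 Thm 1(3)+Rem.(a) kills any R-dense skeleton ∪ sprinkling; odometer grids are not totally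
ergodic; fiid cells irregular; Lean XL.) [HaggstromMester2009, BenjaminiTassion2017,
BenjaminiHaggstromSchramm2000, Grimmett1999, BurtonKeane1989, AngelHutchcroft2018]
#3 FKGHalfSpaceRigidity (crux) — X of the thesis: every probability measure on bond configurations
of ℤ³ that is IsInsertionTolerantErgodic, deletion-tolerant, ergodic under every non-zero
translation, invariant under every graph automorphism of ℤ³, positively associated (μ(A ∩ B) ≥ μ(A)
μ(B) for increasing measurable A, B) and has a.s. only finite clusters in every half-space {a ≤
x_i}, {x_i ≤ a}, does not percolate: μ(|C(0)| = ∞) = 0 (card potemkin-weaver Crux 2 'PotemkinFKG' in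
its positive form = the pivot of cards fkg-weaver-monotone-dag and ust-hull-potemkin Crux 3, weaving
version). [difficulty: open-problem] (why it might fail: Likely FALSE if an FKG weaver exists (card
fkg-weaver-monotone-dag: increasing image of iid labels, multi-parent near-critical hierarchy,
critically reliable tubes). If true, a proof must turn BGN half-space finiteness + association into
a bulk statement — unknown even for Bernoulli.) [Grimmett1999, BarskyGrimmettNewman1991, Harris1960,
BenjaminiTassion2017, LiggettSchonmannStacey1997, HaggstromMester2009]
#4 ErgodicWeaverExists (crux) — the card's literal Crux 1 (entry rung; PotemkinWeaverExists →
ErgodicWeaverExists): a probability measure on bond configurations of ℤ³ that is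
IsInsertionTolerantErgodic (translation-invariant, ℤ³-ergodic, insertion-tolerant),
deletion-tolerant, percolating, with a.s. only finite clusters in every coordinate half-space;
random-offset (odometer) hierarchies are allowed here. Its proof already shows that stationarity,
ℤ³-ergodicity, finite energy both ways, uniqueness, mass transport and BGN/DST-type half-space/slab
finiteness are jointly consistent with a jump. [difficulty: L] (why it might fail: False iff
stationarity + ℤ³-ergodicity + finite energy + half-space finiteness force θ=0 (no such theorem;
HM2009/BHS2000 point the other way). Construction risks: Borel–Cantelli over the hierarchy after
stationarisation, deletion tolerance vs thin tubes, heavy-tailed pieces at the plane.)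
[HaggstromMester2009, Grimmett1999, LyonsPeres2016, BurtonKeane1989, BenjaminiTassion2017,
BenjaminiHaggstromSchramm2000]
#9 BernoulliSoftPortrait (support) — Bernoulli bond percolation on ℤ³ at p = p_c satisfies every
hypothesis of FKGHalfSpaceRigidity: IsInsertionTolerantErgodic (lattice support; translation
invariance = bondPercolation_real_preimage_shift; zero–one from
ergodic_relabel_shift_bondPercolation; insertion tolerance =
bondPercolation_pow_mul_real_preimage_openEdges_le with 0 < p_c), deletion tolerance ((1 -
p_c)^{|E(Λ_N)|}, p_c < 1: Grimmett1999_criticalProb_pos_lt_one_holds), ergodicity under every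
non-zero shift (ergodic_relabel_shift_bondPercolation), automorphism invariance
(BondPercolationSymmetry), positive association (harris_fkg_holds), and a.s. finiteness of all
half-space clusters (BarskyGrimmettNewman1991_Z3_holds at the root of {0 ≤ x_0}; other roots by
Harris + insertion of a path; other half-spaces by coordinate symmetries and translations;
induced-graph vs openConnIn bridge as in ConstrainedClusters.lean). Provable now, ~400–700 lines.
[difficulty: provable-now] [BarskyGrimmettNewman1991, Grimmett1999, Harris1960, BurtonKeane1989,
AizenmanDuminilCopinSidoraviciusCMP2015]

TWO-LAYER PLAN. Foreseen glued splits (k ≤ 3, depth 1), filed only after a crux moves: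
ErgodicWeaverExists ⇐ MoatSkeleton → OdometerPlacement → NoiseRobustness → ErgodicWeaverExists,
where MoatSkeleton is the
deterministic parametrised geometry (level-k units of side L_k, L_{k+1} = M_k L_k with Σ 1/M_k < ∞;
level-0 solid blobs;
one spine per unit, a tube of cross-section w_k² ≥ C log ℓ_k tracing a curve that wiggles at all
scales and, between any two
consecutive attachment points, overshoots its unit by A_k ≥ L_k in all six directions; units
separated by moats of width
D_k ≥ C log L_k carrying only noise; single attachment to the parent spine), OdometerPlacement the
random nested offsets,
NoiseRobustness the statement that XOR-ing independent Bernoulli(ε) noise (which gives uniform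
insertion AND deletion
tolerance for free) keeps a unique dense infinite cluster with finite half-space pieces (Peierls for
tube cuts, subcritical
bridging of moats: L_k²(Cε)^{D_k} summable, Borel–Cantelli over the hierarchy).
PotemkinWeaverExists ⇐ MoatSkeleton → MixingPlacement → NoiseRobustness, MixingPlacement = a
factor-of-iid (Voronoi /
Matérn cells at scales L_k) or otherwise totally ergodic nesting replacing the odometer.
FKGHalfSpaceRigidity, if attacked positively ⇐ (association + finite energy + half-space finiteness
⇒ a same-p finite-size
criterion in the half-space) → (criterion ⇒ no bulk percolation); if attacked negatively it is the
fkg-weaver card's O1–O6.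

KILL CRITERIA. ErgodicWeaverExists REFUTED (a theorem 'stationary ℤ³-ergodic finite-energy measures
with all half-space pieces finite do not
percolate') ⇒ PotemkinWeaverExists refuted and FKGHalfSpaceRigidity PROVED a fortiori ⇒ with
BernoulliSoftPortrait the
conjunct follows: the BROKEN flag is then repaired by `--drop` of the two existence items (not
load-bearing for the Assembly)
and the route closes positively. PotemkinWeaverExists refuted while ErgodicWeaverExists proved ⇒
total ergodicity/mixing is a
genuine lever: tenure restates X without FKG but with mixing (MixingHalfSpaceRigidity) as the new
positive crux.
FKGHalfSpaceRigidity REFUTED (an FKG weaver) ⇒ close `refuted:FKGHalfSpaceRigidity` with census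
'soft + FKG barrier complete;
positive routes must use independence quantitatively (BK/Reimer, AKN two-arm counting, Russo/Le Cam,
exits identity, exact
independence across a plane)'; the refuting theorem enters `ledger negatives` as summit-wide
negative knowledge — the
intended terminal state of this negative-side line. PercolationContinuityZ3 proved elsewhere ⇒ close
superseded (the weaver
items keep their barrier value as Literature/Barriers material).

NOT DECOMPOSED YET. The skeleton geometry (corridor routing of overshooting spines of all levels,
vertex-disjointness, wiggling at all scales),
the stationarisation mechanism (odometer vs factor-of-iid cells and their irregularity), the noise
Borel–Cantelli, one-endedness
and tail-triviality upgrades, point-group symmetrisation of the witnesses, and the card's Crux 3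
'audit table' (which soft
lemmas of PercLowPointHalfSpace / PercFiniteBoxLRO / PercOpenSupercrit / PercTruncatedSusceptibility
hold on a weaver) — the
latter is refuter evidence work once a witness exists, not an item. Also not filed: the
no-finite-energy rung (realised by
the uniform spanning tree, card ust-hull-potemkin P7; 'known' modulo UST formalisation) and the 2D
contrast.

CHEAPEST FALSIFIER. For any proposed weaver DESIGN two lookups kill the common mistakes: (i)
BenjaminiTassion2017 Thm 1 item (3) + Remark (a):
(R-dense skeleton with unique infinite cluster) ∪ independent ε-sprinkling percolates in the upper
half-space a.s. — so
'UST ∪ noise' and every bounded-moat or uniformly dense design is dead; moats must have unbounded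
width; (ii) a random-offset
(odometer) grid is not ergodic under a single translation, so it can serve ErgodicWeaverExists only.
For the STATEMENTS: the
mass-transport attempt (card; redone here) yields only θ₀ = E[|U ∩ layer_r| / |U ∩ ∂H| ; 0 ∈ K] for
every depth r, hence
E[|U|/|U ∩ ∂H|] = ∞ (heavy-tailed pieces, no contradiction); and every finite half-space piece of
the infinite cluster touches
the boundary plane, so depth-uniform bounds on piece diameters are impossible ('uniformly weaving'
skeletons do not exist;
Cesàro stationarisation must control the density of large pieces). For crux 3: the kit simulation of
card
fkg-weaver-monotone-dag (bipartite Poissonian sibling graph) is the cheapest evidence either way.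

NUMBERS. p_c^bond(ℤ³) ≈ 0.2488 (numerical); 0 < p_c < 1 proved
(Grimmett1999_criticalProb_pos_lt_one_holds). Heuristic design budget
with SUBcritical noise ε ∈ (0, p_c) (critical noise, as in the card, is not required by the
statements): moat width
D_k ≥ C log L_k (bridging L_k²(Cε)^{D_k} summable), tube cross-section w_k² ≥ C log ℓ_k (Peierls cut
probability ℓ_k (Cε)^{w_k²}
summable), scale ratios M_k → ∞ with Σ_k (D_k/L_k + 6/M_k) < ∞ for positive density, spine length ≈
12 M_{k-1}⁴ L_{k-1}
(volume fraction M_{k-1}/L_{k-1}², negligible). Items at open: 5 (3 cruxes, 1 support, 1 assembly).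

DEFINITION REQUESTS. To be filed after open (both are inlined in the statements meanwhile, so
nothing blocks): IsDeletionTolerant μ (box form,
the twin of IsInsertionTolerantErgodic.insertion_tolerant: ∀ N ∃ c > 0, c · μ{ω : ω minus E(Λ_N) ∈
S} ≤ μ S) and
IsPositivelyAssociated μ (μ(A ∩ B) ≥ μ A · μ B for increasing measurable A, B), topic
Literature/Probability/Percolation;
shared with any route realising fkg-weaver-monotone-dag / fkg-kills-fragility.

Novelty: Searches (2026-08-15): `lit search --hybrid "stationary finite energy percolation unique infinite
cluster half-space finite components counterexample"` (12 textbook hits: Grimmett1999,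
LyonsPeres2016, BollobasRiordan2006 …, nothing specific); `lit vsearch` of the crux in prose (10
textbooks, nothing specific); `lit galaxy search "finite energy percolation half-space" --star all`
(0 rows; a second galaxy query queued out); `lit frontier CriticalPhenomena --since 2020` (30 rows,
none on invariant finite-energy percolation); `lit bridges CriticalPhenomena --cross any` (none
relevant); zbMATH leg 0 rows; arXiv/OpenAlex legs rate-limited (HTTP 429); `lit read`
arXiv:1011.2872 pp.3–5 (HM2009 Def 1.1, Thm 1.2, the UST-based finite-energy trick),
arXiv:1505.06069 pp.3–4, 9 (BT2017 Thm 1 items 1–5, Remark (a), Questions 1–3), Grimmett1999 PDF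
p.176 (= p.163); plus today's refuter audits of cards potemkin-weaver, fkg-weaver-monotone-dag,
ust-hull-potemkin, which searched the same space (crossref/zbMATH/galaxy) and found no finite-energy
weaving measure on ℤ³ in print.
Nearest prior art found: HaggstromMester2009 (doi:10.1214/ecp.v14-1446) Thm 1.2 —
translation-invariant uniformly-finite-energy counterexample measures on ℤ² (coexistence), the
construction genre; BenjaminiHaggstromSchramm2000 (doi:10.1063/1.533187) and BenjaminiTassion2017
(arXiv:1505.06069) Question 1 / Thm 1 — insertion-tolerant percolating X with p_c(X) = 1, the open
finite-energy version, and homogenisation of sprink  [refs: 10.1214/ecp.v14-1446, 10.1063/1.533187, 1011.2872, 1505.06069, 1710.03003, doi:10.1214/ecp.v14-1446, doi:10.1063/1.533187, Grimmett1999, LyonsPeres2016, BollobasRiordan2006, HaggstromMester2009, BenjaminiHaggstromSchramm2000, BenjaminiTassion2017, AngelHutchcroft2018]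

Barriers (technique_class: weaving-measure finite-energy invariant-percolation): - technique_class: weaving-measure finite-energy invariant-percolation
- Literature.Barriers.CriticalPhenomena.SprinklingRenormalisation: nothing is renormalised or
sprinkled; the route sharpens the barrier's moral from the other side — even granting the same-p
half-space conclusion (BGN, proved) plus uniqueness and finite energy, cruxes 2/4 say the bulk
statement does not follow softly, and crux 3 names the one soft-plus-FKG statement that would;
BenjaminiTassion2017's sprinkling homogenisation is used as a design CONSTRAINT (moats of unbounded
width), not as a tool.
- Literature.Barriers.CriticalPhenomena.RandomClusterFirstOrder: FKGHalfSpaceRigidity carries the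
hypothesis 'all half-space pieces finite', which the wired random-cluster measure at a first-order
point violates (ordered phase percolates in slabs and half-spaces), so a proof of crux 3 is not a
q-uniform FKG/finite-energy/sharpness argument and does not contradict Grimmett2006 Thm (7.33); the
weaver cruxes complement the barrier (short-range, dependent, half-space-finite witnesses versus the
RC witness which is FKG but half-space-percolating).
- Literature.Barriers.CriticalPhenomena.AmenableInvariantPercolationNarrow: applies to the POSITIVE
crux only in spirit and is evaded by hypothesis count — FKGHalfSpaceRigidity is not a
cluster-size-blind density/degree threshold for all invariant percolations with finite clusters (the
class LP Thm 8.37 kills on amenable ℤ³): its hypotheses add finite energy both ways, tota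

Novelty grade: new-combination — ROUTE REVIEW (refuter 2026-08-15). ELAB: all 5 decls rc0. ASSEMBLY stmt-4884 PROVED in my folder (PotemkinAssemblyProof.lean `assembly_holds`, 0 sorry, std axioms; attached as evidence): destructure BernoulliSoftPortrait, instantiate X at P_{p_c}, measureReal_def. Glue ¬X→PotemkinWeaverExists→Ergodi (refuter refuter-rreview-route-CriticalPhenomena--64a1fcbe-0, 2026-08-15T13:34:35Z; prior: HaggstromMester2009 doi:10.1214/ecp.v14-1446 Thm 1.2 (finite-energy invariant counterexample measures, Z^2), BenjaminiHaggstromSchramm2000 doi:10.1063/1.533187 / BenjaminiTassion2017 arXiv:1505.06069 Thm 1(3), Rem (a), Q1, BarskyGrimmettNewman1991 = Grimmett1999 Thm (7.35) (proved in tree: BarskyGrimmettNewman1991_Z3_holds), BurtonKeane1989 (in tree: ae_numInfiniteClusters_le_one_of_isInsertionTol)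

sub-problem: PercolationContinuityZ3 · status: open · opened planner-plancard-CriticalPhenomena-Percolatio-5a26a2b7-0 2026-08-15T11:35:30Z · rev 4 · ledger route-CriticalPhenomena-PercPotemkinWeaver
GENERATED by the gate from the ledger (D-0016/17). Provers cite these decls: `theorem foo : Summit.CriticalPhenomena.PercolationContinuityZ3.Theses.PercPotemkinWeaver.<Decl> := …` in Summits/CriticalPhenomena/PercolationContinuityZ3/Theorems/<Name>.lean.
-/

namespace Summit.CriticalPhenomena.PercolationContinuityZ3.Theses.PercPotemkinWeaver

open scoped BigOperators Topology Manifold Classical MeasureTheory ProbabilityTheory Matrix InnerProductSpace ComplexConjugate ContinuousMap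
open Filter Set Function TopologicalSpace MeasureTheory

attribute [summit_statement] _root_.PercolationContinuityZ3

/-- item stmt-CriticalPhenomena-4880 · crux · rank 2 · open · by planner
why it might fail: Existence may be FALSE: ergodicity under EVERY single shift + box-uniform insertion AND deletion tolerance + all half-space pieces finite could force θ=0 (no theorem either way). Design traps: BT2017 Thm 1(3)+Rem.(a) kill every R-dense skeleton ∪ independent noise; odometer offsets not tot. ergodic.
sources: BenjaminiTassion2017, HaggstromMester2009, BenjaminiHaggstromSchramm2000, Grimmett1999, BurtonKeane1989, AngelHutchcroft2018
[crux] there is a probability measure μ on bond configurations of ℤ³ which is translation-invariant,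
ℤ³-ergodic and insertion-tolerant (IsInsertionTolerantErgodic μ, hence a.s. unique infinite cluster
by the in-tree Burton–Keane theorem), deletion-tolerant (closing the edges of any box costs at most
a factor), ergodic under every single non-zero translation, percolating (μ(|C(0)| = ∞) > 0), and
such that a.s. every cluster of the configuration restricted to every half-space {a ≤ x_i} and {x_i
≤ a} is finite (card potemkin-weaver Crux 1, strengthened by total ergodicity; slabs follow from
half-spaces). [difficulty: XL] -/
@[route_item "route-CriticalPhenomena-PercPotemkinWeaver"]
def PotemkinWeaverExists : Prop :=
  ∃ μ : MeasureTheory.Measure (Literature.Probability.Percolation.BondConfig (Literature.Probability.LatticeModels.Site 3)), MeasureTheory.IsProbabilityMeasure μ ∧ (∀ᵐ ω ∂μ, ω ⊆ (Literature.Probability.LatticeModels.zdGraph 3).edgeSet) ∧ (∀ (v : Literature.Probability.LatticeModels.Site 3) (S : Set (Literature.Probability.Percolation.BondConfig (Literature.Probability.LatticeModels.Site 3))), MeasurableSet S → μ (Literature.Probability.Percolation.BondConfig.relabel (Literature.Probability.Percolation.sym2Equiv (Literature.Probability.LatticeModels.Site.shift v)) ⁻¹' S) = μ S) ∧ (∀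 S : Set (Literature.Probability.Percolation.BondConfig (Literature.Probability.LatticeModels.Site 3)), MeasurableSet S → (∀ v : Literature.Probability.LatticeModels.Site 3, Literature.Probability.Percolation.BondConfig.relabel (Literature.Probability.Percolation.sym2Equiv (Literature.Probability.LatticeModels.Site.shift v)) ⁻¹' S = S) → μ S = 0 ∨ μ S = 1) ∧ (∀ N : ℕ, ∃ c : ℝ, 0 < c ∧ ∀ S : Set (Literature.Probability.Percolation.BondConfig (Literature.Probability.LatticeModels.Site 3)), MeasurableSet S → c * μ.real ((fun ω : Literature.Probability.Percolation.BondConfig (Literature.Probability.LatticeModels.Site 3) => ω ∪ ↑(Literature.Probability.LatticeModels.edgesIn (Literature.Probability.LatticeModels.zdGraph 3) (Literature.Probability.LatticeModels.box 3 N))) ⁻¹' S) ≤ μ.real S) ∧ (∀ N : ℕ, ∃ c : ℝ, 0 < c ∧ ∀ S : Set (Literature.Probability.Percolation.BondConfig (Literature.Probability.LatticeModels.Site 3)), MeasurableSet S → c * μ.real ((fun ω : Literature.Probability.Percolation.BondConfig (Literature.Probability.LatticeModels.Site 3) => ω \ ↑(Literature.Probability.LatticeModels.edgesIn (Literature.Probability.LatticeModels.zdGraph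 3) (Literature.Probability.LatticeModels.box 3 N))) ⁻¹' S) ≤ μ.real S) ∧ (∀ v : Literature.Probability.LatticeModels.Site 3, v ≠ 0 → Ergodic (Literature.Probability.Percolation.BondConfig.relabel (Literature.Probability.Percolation.sym2Equiv (Literature.Probability.LatticeModels.Site.shift v))) μ) ∧ 0 < μ.real (Literature.Probability.Percolation.percolatesAt (0 : Literature.Probability.LatticeModels.Site 3)) ∧ (∀ᵐ ω ∂μ, ∀ (i : Fin 3) (a : ℤ) (v : Literature.Probability.LatticeModels.Site 3), {y : Literature.Probability.LatticeModels.Site 3 | ω ∈ Literature.Probability.Percolation.openConnIn {x : Literature.Probability.LatticeModels.Site 3 | a ≤ x i} v y}.Finite ∧ {y : Literature.Probability.LatticeModels.Site 3 | ω ∈ Literature.Probability.Percolation.openConnIn {x : Literature.Probability.LatticeModels.Site 3 | x i ≤ a} v y}.Finite)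

/-- item stmt-CriticalPhenomena-4881 · crux · rank 3 · open · by planner
why it might fail: Likely FALSE: an FKG weaver (increasing image of iid labels, multi-parent hierarchy; card fkg-weaver-monotone-dag) refutes it. X also forces half-space percolation of wired RC at p_c(q), q≫1 on ℤ³ (Grimmett2006 Thm 4.19/7.33: all other hyps hold), PS folklore only. If TRUE: open even for Bernoulli.
sources: Grimmett1999, BarskyGrimmettNewman1991, Harris1960, Grimmett2006, LaanaitMessagerMiracleSoleRuizShlosman1991, LiggettSchonmannStacey1997
[crux] X of the thesis: every probability measure on bond configurations of ℤ³ that is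
IsInsertionTolerantErgodic, deletion-tolerant, ergodic under every non-zero translation, invariant
under every graph automorphism of ℤ³, positively associated (μ(A ∩ B) ≥ μ(A) μ(B) for increasing
measurable A, B) and has a.s. only finite clusters in every half-space {a ≤ x_i}, {x_i ≤ a}, does
not percolate: μ(|C(0)| = ∞) = 0 (card potemkin-weaver Crux 2 'PotemkinFKG' in its positive form =
the pivot of cards fkg-weaver-monotone-dag and ust-hull-potemkin Crux 3, weaving version).
[difficulty: open-problem] -/
@[route_item "route-CriticalPhenomena-PercPotemkinWeaver"]
def FKGHalfSpaceRigidity : Prop :=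
  ∀ μ : MeasureTheory.Measure (Literature.Probability.Percolation.BondConfig (Literature.Probability.LatticeModels.Site 3)), MeasureTheory.IsProbabilityMeasure μ → (∀ᵐ ω ∂μ, ω ⊆ (Literature.Probability.LatticeModels.zdGraph 3).edgeSet) → (∀ (v : Literature.Probability.LatticeModels.Site 3) (S : Set (Literature.Probability.Percolation.BondConfig (Literature.Probability.LatticeModels.Site 3))), MeasurableSet S → μ (Literature.Probability.Percolation.BondConfig.relabel (Literature.Probability.Percolation.sym2Equiv (Literature.Probability.LatticeModels.Site.shift v)) ⁻¹' S) = μ S) → (∀ S : Set (Literature.Probability.Percolation.BondConfig (Literature.Probability.LatticeModels.Site 3)), MeasurableSet S → (∀ v : Literature.Probability.LatticeModels.Site 3, Literature.Probability.Percolation.BondConfig.relabel (Literature.Probability.Percolation.sym2Equiv (Literature.Probability.LatticeModels.Site.shift v)) ⁻¹' S = S) → μ S = 0 ∨ μ S = 1) → (∀ N : ℕ, ∃ c : ℝ, 0 < c ∧ ∀ S : Set (Literature.Probability.Percolation.BondConfig (Literature.Probability.LatticeModels.Site 3)), MeasurableSet S → c * μ.real ((fun ω : Literature.Probability.Percolation.BondConfig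 (Literature.Probability.LatticeModels.Site 3) => ω ∪ ↑(Literature.Probability.LatticeModels.edgesIn (Literature.Probability.LatticeModels.zdGraph 3) (Literature.Probability.LatticeModels.box 3 N))) ⁻¹' S) ≤ μ.real S) → (∀ N : ℕ, ∃ c : ℝ, 0 < c ∧ ∀ S : Set (Literature.Probability.Percolation.BondConfig (Literature.Probability.LatticeModels.Site 3)), MeasurableSet S → c * μ.real ((fun ω : Literature.Probability.Percolation.BondConfig (Literature.Probability.LatticeModels.Site 3) => ω \ ↑(Literature.Probability.LatticeModels.edgesIn (Literature.Probability.LatticeModels.zdGraph 3) (Literature.Probability.LatticeModels.box 3 N))) ⁻¹' S) ≤ μ.real S) → (∀ v : Literature.Probability.LatticeModels.Site 3, v ≠ 0 → Ergodic (Literature.Probability.Percolation.BondConfig.relabel (Literature.Probability.Percolation.sym2Equiv (Literature.Probability.LatticeModels.Site.shift v))) μ) → (∀ (γ : Literature.Probability.LatticeModels.zdGraph 3 ≃g Literature.Probability.LatticeModels.zdGraph 3) (A : Set (Literature.Probability.Percolation.BondConfig (Literature.Probability.LatticeModels.Site 3))), MeasurableSet A → μ (Literature.Probability.Percolation.BondConfig.relabel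 (Literature.Probability.Percolation.sym2Equiv γ.toEquiv) ⁻¹' A) = μ A) → (∀ A B : Set (Literature.Probability.Percolation.BondConfig (Literature.Probability.LatticeModels.Site 3)), IsUpperSet A → IsUpperSet B → MeasurableSet A → MeasurableSet B → μ A * μ B ≤ μ (A ∩ B)) → (∀ᵐ ω ∂μ, ∀ (i : Fin 3) (a : ℤ) (v : Literature.Probability.LatticeModels.Site 3), {y : Literature.Probability.LatticeModels.Site 3 | ω ∈ Literature.Probability.Percolation.openConnIn {x : Literature.Probability.LatticeModels.Site 3 | a ≤ x i} v y}.Finite ∧ {y : Literature.Probability.LatticeModels.Site 3 | ω ∈ Literature.Probability.Percolation.openConnIn {x : Literature.Probability.LatticeModels.Site 3 | x i ≤ a} v y}.Finite) → μ (Literature.Probability.Percolation.percolatesAt (0 : Literature.Probability.LatticeModels.Site 3)) = 0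

/-- item stmt-CriticalPhenomena-4882 · crux · rank 4 · open · by planner
why it might fail: False iff 'stationary + ℤ³-ergodic + box-uniform finite energy both ways + all half-space pieces finite ⇒ θ=0' is a theorem — none known, none excluded (MTP gives only E[|piece|/|piece∩∂H|]=∞). Build risks: Borel–Cantelli over the stationarised hierarchy, deletion tolerance vs thin tubes.
sources: HaggstromMester2009, BenjaminiTassion2017, BenjaminiHaggstromSchramm2000, LyonsPeres2016, BurtonKeane1989, Grimmett1999
[crux] the card's literal Crux 1 (entry rung; PotemkinWeaverExists → ErgodicWeaverExists): a
probability measure on bond configurations of ℤ³ that is IsInsertionTolerantErgodic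
(translation-invariant, ℤ³-ergodic, insertion-tolerant), deletion-tolerant, percolating, with a.s.
only finite clusters in every coordinate half-space; random-offset (odometer) hierarchies are
allowed here. Its proof already shows that stationarity, ℤ³-ergodicity, finite energy both ways,
uniqueness, mass transport and BGN/DST-type half-space/slab finiteness are jointly consistent with a
jump. [difficulty: L] -/
@[route_item "route-CriticalPhenomena-PercPotemkinWeaver"]
def ErgodicWeaverExists : Prop :=
  ∃ μ : MeasureTheory.Measure (Literature.Probability.Percolation.BondConfig (Literature.Probability.LatticeModels.Site 3)), MeasureTheory.IsProbabilityMeasure μ ∧ (∀ᵐ ω ∂μ, ω ⊆ (Literature.Probability.LatticeModels.zdGraph 3).edgeSet) ∧ (∀ (v : Literature.Probability.LatticeModels.Site 3) (S : Set (Literature.Probability.Percolation.BondConfig (Literature.Probability.LatticeModels.Site 3))), MeasurableSet S → μ (Literature.Probability.Percolation.BondConfig.relabel (Literature.Probability.Percolation.sym2Equiv (Literature.Probability.LatticeModels.Site.shift v)) ⁻¹' S) = μ S) ∧ (∀ S : Set (Literature.Probability.Percolation.BondConfig (Literature.Probability.LatticeModels.Site 3)), MeasurableSet S → (∀ v : Literature.Probability.LatticeModels.Site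 3, Literature.Probability.Percolation.BondConfig.relabel (Literature.Probability.Percolation.sym2Equiv (Literature.Probability.LatticeModels.Site.shift v)) ⁻¹' S = S) → μ S = 0 ∨ μ S = 1) ∧ (∀ N : ℕ, ∃ c : ℝ, 0 < c ∧ ∀ S : Set (Literature.Probability.Percolation.BondConfig (Literature.Probability.LatticeModels.Site 3)), MeasurableSet S → c * μ.real ((fun ω : Literature.Probability.Percolation.BondConfig (Literature.Probability.LatticeModels.Site 3) => ω ∪ ↑(Literature.Probability.LatticeModels.edgesIn (Literature.Probability.LatticeModels.zdGraph 3) (Literature.Probability.LatticeModels.box 3 N))) ⁻¹' S) ≤ μ.real S) ∧ (∀ N : ℕ, ∃ c : ℝ, 0 < c ∧ ∀ S : Set (Literature.Probability.Percolation.BondConfig (Literature.Probability.LatticeModels.Site 3)), MeasurableSet S → c * μ.real ((fun ω : Literature.Probability.Percolation.BondConfig (Literature.Probability.LatticeModels.Site 3) => ω \ ↑(Literature.Probability.LatticeModels.edgesIn (Literature.Probability.LatticeModels.zdGraph 3) (Literature.Probability.LatticeModels.box 3 N))) ⁻¹' S) ≤ μ.real S) ∧ 0 < μ.real (Literature.Probability.Percolation.percolatesAt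 (0 : Literature.Probability.LatticeModels.Site 3)) ∧ (∀ᵐ ω ∂μ, ∀ (i : Fin 3) (a : ℤ) (v : Literature.Probability.LatticeModels.Site 3), {y : Literature.Probability.LatticeModels.Site 3 | ω ∈ Literature.Probability.Percolation.openConnIn {x : Literature.Probability.LatticeModels.Site 3 | a ≤ x i} v y}.Finite ∧ {y : Literature.Probability.LatticeModels.Site 3 | ω ∈ Literature.Probability.Percolation.openConnIn {x : Literature.Probability.LatticeModels.Site 3 | x i ≤ a} v y}.Finite)

/-- item stmt-CriticalPhenomena-18903 · crux · rank 5 · open · by planner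
why it might fail: An FKG MOSAIC — dense ordered cells separated by a stationary net of closed membranes with pinholes, finite energy, totally ergodic — would be monolithic yet weave; coarse-graining without k-dependence has no Peierls step (ε-density bad blocks may form shells), so association must work twice.
sources: LiggettSchonmannStacey1997, AntalPisztora1996, BarskyGrimmettNewman1991, Grimmett1999, arXiv:1902.03207, Grimmett2006
[crux] X₂ of the split of FKGHalfSpaceRigidity — MONOLITHIC FKG GIANTS PERCOLATE IN HALF-SPACES:
every probability measure on bond configurations of ℤ³ with the soft portrait of the parent,
percolating with a.s. exactly one infinite cluster and MONOLITHIC (∃δ>0: P(Λ_n has an open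
box-cluster with ≥ δ|Λ_n| vertices) → 1), is NOT such that a.s. every cluster of every coordinate
half-space {a ≤ x_i}, {x_i ≤ a} is finite. This is the half-space renormalisation half of the
parent: dense pieces of overlapping boxes must be GLUED (dense-piece uniqueness: two disjoint
δ-dense pieces of a box are separated by a closed membrane of ≍ n² edges touching open mass on both
sides, an increasing×decreasing pattern that association penalises) and then coarse-grained INSIDE
the half-space without independence (no Liggett–Schonmann–Stacey domination for merely associated
block fields; finite energy + ergodicity must replace it). Bernoulli instance at p_c: 'no dense
critical box pieces w.h.p.' — implied by θ(p_c)=0 (dense pieces w.h.p. force θ>0 by stationarity),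
does not imply it; for p>p_c it is Grimmett–Marstrand/BGN (tree). [difficulty: open-problem] -/
@[route_item "route-CriticalPhenomena-PercPotemkinWeaver"]
def DenseGiantHalfSpace : Prop :=
  ∀ μ : MeasureTheory.Measure (Literature.Probability.Percolation.BondConfig (Literature.Probability.LatticeModels.Site 3)), MeasureTheory.IsProbabilityMeasure μ → (∀ᵐ ω ∂μ, ω ⊆ (Literature.Probability.LatticeModels.zdGraph 3).edgeSet) → (∀ (v : Literature.Probability.LatticeModels.Site 3) (S : Set (Literature.Probability.Percolation.BondConfig (Literature.Probability.LatticeModels.Site 3))), MeasurableSet S → μ (Literature.Probability.Percolation.BondConfig.relabel (Literature.Probability.Percolation.sym2Equiv (Literature.Probability.LatticeModels.Site.shift v)) ⁻¹' S) = μ S) → (∀ S : Set (Literature.Probability.Percolation.BondConfig (Literature.Probability.LatticeModels.Site 3)), MeasurableSet S → (∀ v : Literature.Probability.LatticeModels.Site 3, Literature.Probability.Percolation.BondConfig.relabel (Literature.Probability.Percolation.sym2Equiv (Literature.Probability.LatticeModels.Site.shift v)) ⁻¹' S = S) → μ S = 0 ∨ μ S = 1) → (∀ N : ℕ, ∃ c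 : ℝ, 0 < c ∧ ∀ S : Set (Literature.Probability.Percolation.BondConfig (Literature.Probability.LatticeModels.Site 3)), MeasurableSet S → c * μ.real ((fun ω : Literature.Probability.Percolation.BondConfig (Literature.Probability.LatticeModels.Site 3) => ω ∪ ↑(Literature.Probability.LatticeModels.edgesIn (Literature.Probability.LatticeModels.zdGraph 3) (Literature.Probability.LatticeModels.box 3 N))) ⁻¹' S) ≤ μ.real S) → (∀ N : ℕ, ∃ c : ℝ, 0 < c ∧ ∀ S : Set (Literature.Probability.Percolation.BondConfig (Literature.Probability.LatticeModels.Site 3)), MeasurableSet S → c * μ.real ((fun ω : Literature.Probability.Percolation.BondConfig (Literature.Probability.LatticeModels.Site 3) => ω \ ↑(Literature.Probability.LatticeModels.edgesIn (Literature.Probability.LatticeModels.zdGraph 3) (Literature.Probability.LatticeModels.box 3 N))) ⁻¹' S) ≤ μ.real S) → (∀ v : Literature.Probability.LatticeModels.Site 3, v ≠ 0 → Ergodic (Literature.Probability.Percolation.BondConfig.relabel (Literature.Probability.Percolation.sym2Equiv (Literature.Probability.LatticeModels.Site.shift v))) μ) → (∀ (γ : Literature.Probability.LatticeModels.zdGraph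 3 ≃g Literature.Probability.LatticeModels.zdGraph 3) (A : Set (Literature.Probability.Percolation.BondConfig (Literature.Probability.LatticeModels.Site 3))), MeasurableSet A → μ (Literature.Probability.Percolation.BondConfig.relabel (Literature.Probability.Percolation.sym2Equiv γ.toEquiv) ⁻¹' A) = μ A) → (∀ A B : Set (Literature.Probability.Percolation.BondConfig (Literature.Probability.LatticeModels.Site 3)), IsUpperSet A → IsUpperSet B → MeasurableSet A → MeasurableSet B → μ A * μ B ≤ μ (A ∩ B)) → 0 < μ.real (Literature.Probability.Percolation.percolatesAt (0 : Literature.Probability.LatticeModels.Site 3)) → (∀ᵐ ω ∂μ, Literature.Probability.Percolation.numInfiniteClusters ω = 1) → (∃ δ : ℝ, 0 < δ ∧ ∀ η : ℝ, 0 < η → ∃ N : ℕ, ∀ n : ℕ, N ≤ n → 1 - η ≤ μ.real {ω | ∃ x ∈ Literature.Probability.LatticeModels.box 3 n, δ * ((Literature.Probability.LatticeModels.box 3 n).card : ℝ) ≤ (({y : Literature.Probability.LatticeModels.Site 3 | ω ∈ Literature.Probability.Percolation.openConnIn (↑(Literature.Probability.LatticeModels.box 3 n) : Set (Literature.Probability.LatticeModels.Site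 3)) x y}).ncard : ℝ)}) → ¬ (∀ᵐ ω ∂μ, ∀ (i : Fin 3) (a : ℤ) (v : Literature.Probability.LatticeModels.Site 3), {y : Literature.Probability.LatticeModels.Site 3 | ω ∈ Literature.Probability.Percolation.openConnIn {x : Literature.Probability.LatticeModels.Site 3 | a ≤ x i} v y}.Finite ∧ {y : Literature.Probability.LatticeModels.Site 3 | ω ∈ Literature.Probability.Percolation.openConnIn {x : Literature.Probability.LatticeModels.Site 3 | x i ≤ a} v y}.Finite)

/-- item stmt-CriticalPhenomena-18904 · crux · rank 6 · open · by planner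
why it might fail: A SHATTERED FKG giant may exist: unique, positive density, yet largest box-cluster o(n³) (strands merging only through ever rarer junctions). FKG square-root/symmetry arguments give box CROSSINGS w.h.p., not volume-dense pieces; Potemkin-type weavers are shattered by design (but not FKG).
sources: Pisztora1996, AntalPisztora1996, arXiv:1212.2885, BurtonKeane1989, Grimmett1999, arXiv:2202.07634
[crux] X₁ of the split of FKGHalfSpaceRigidity — FKG GIANTS ARE MONOLITHIC (not shattered): every
probability measure on bond configurations of ℤ³ with the soft portrait of the parent (lattice
support, translation invariance, ℤ³-ergodicity, box insertion AND deletion tolerance, ergodicity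
under every non-zero shift, Aut(ℤ³)-invariance, positive association) which percolates (μ(|C(0)|=∞)
> 0) with a.s. exactly one infinite cluster has, for some δ > 0, P(Λ_n contains an open box-cluster
— a component of the open subgraph induced on Λ_n — with ≥ δ|Λ_n| vertices) → 1 as n → ∞. NO weaving
hypothesis: a structure theorem for all FKG giants. Known instances: supercritical Bernoulli
(Pisztora 1996, GM slab technology), interlacements / vacant set / GFF level sets in their
local-uniqueness regimes (Drewitz–Ráth–Sapozhnikov arXiv:1212.2885, condition S1 proved model by
model from decoupling inequalities — nothing for general associated measures). Bernoulli instance at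
p_c: 'the jump world, if any, is monolithic' = the negation of the shattered branch (cards
free-box-shattering-is-a-branch, dense-piece-uniqueness-hub); implied by θ(p_c)=0, does not imply
it. [difficulty: open-problem] -/
@[route_item "route-CriticalPhenomena-PercPotemkinWeaver"]
def FKGGiantBoxDensity : Prop :=
  ∀ μ : MeasureTheory.Measure (Literature.Probability.Percolation.BondConfig (Literature.Probability.LatticeModels.Site 3)), MeasureTheory.IsProbabilityMeasure μ → (∀ᵐ ω ∂μ, ω ⊆ (Literature.Probability.LatticeModels.zdGraph 3).edgeSet) → (∀ (v : Literature.Probability.LatticeModels.Site 3) (S : Set (Literature.Probability.Percolation.BondConfig (Literature.Probability.LatticeModels.Site 3))), MeasurableSet S → μ (Literature.Probability.Percolation.BondConfig.relabel (Literature.Probability.Percolation.sym2Equiv (Literature.Probability.LatticeModels.Site.shift v)) ⁻¹' S) = μ S) → (∀ S : Set (Literature.Probability.Percolation.BondConfig (Literature.Probability.LatticeModels.Site 3)), MeasurableSet S → (∀ v : Literature.Probability.LatticeModels.Site 3, Literature.Probability.Percolation.BondConfig.relabel (Literature.Probability.Percolation.sym2Equiv (Literature.Probability.LatticeModels.Site.shift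 v)) ⁻¹' S = S) → μ S = 0 ∨ μ S = 1) → (∀ N : ℕ, ∃ c : ℝ, 0 < c ∧ ∀ S : Set (Literature.Probability.Percolation.BondConfig (Literature.Probability.LatticeModels.Site 3)), MeasurableSet S → c * μ.real ((fun ω : Literature.Probability.Percolation.BondConfig (Literature.Probability.LatticeModels.Site 3) => ω ∪ ↑(Literature.Probability.LatticeModels.edgesIn (Literature.Probability.LatticeModels.zdGraph 3) (Literature.Probability.LatticeModels.box 3 N))) ⁻¹' S) ≤ μ.real S) → (∀ N : ℕ, ∃ c : ℝ, 0 < c ∧ ∀ S : Set (Literature.Probability.Percolation.BondConfig (Literature.Probability.LatticeModels.Site 3)), MeasurableSet S → c * μ.real ((fun ω : Literature.Probability.Percolation.BondConfig (Literature.Probability.LatticeModels.Site 3) => ω \ ↑(Literature.Probability.LatticeModels.edgesIn (Literature.Probability.LatticeModels.zdGraph 3) (Literature.Probability.LatticeModels.box 3 N))) ⁻¹' S) ≤ μ.real S) → (∀ v : Literature.Probability.LatticeModels.Site 3, v ≠ 0 → Ergodic (Literature.Probability.Percolation.BondConfig.relabel (Literature.Probability.Percolation.sym2Equiv (Literature.Probability.LatticeModels.Site.shift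 v))) μ) → (∀ (γ : Literature.Probability.LatticeModels.zdGraph 3 ≃g Literature.Probability.LatticeModels.zdGraph 3) (A : Set (Literature.Probability.Percolation.BondConfig (Literature.Probability.LatticeModels.Site 3))), MeasurableSet A → μ (Literature.Probability.Percolation.BondConfig.relabel (Literature.Probability.Percolation.sym2Equiv γ.toEquiv) ⁻¹' A) = μ A) → (∀ A B : Set (Literature.Probability.Percolation.BondConfig (Literature.Probability.LatticeModels.Site 3)), IsUpperSet A → IsUpperSet B → MeasurableSet A → MeasurableSet B → μ A * μ B ≤ μ (A ∩ B)) → 0 < μ.real (Literature.Probability.Percolation.percolatesAt (0 : Literature.Probability.LatticeModels.Site 3)) → (∀ᵐ ω ∂μ, Literature.Probability.Percolation.numInfiniteClusters ω = 1) → ∃ δ : ℝ, 0 < δ ∧ ∀ η : ℝ, 0 < η → ∃ N : ℕ, ∀ n : ℕ, N ≤ n → 1 - η ≤ μ.real {ω | ∃ x ∈ Literature.Probability.LatticeModels.box 3 n, δ * ((Literature.Probability.LatticeModels.box 3 n).card : ℝ) ≤ (({y : Literature.Probability.LatticeModels.Site 3 | ω ∈ Literature.Probability.Percolation.openConnIn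 (↑(Literature.Probability.LatticeModels.box 3 n) : Set (Literature.Probability.LatticeModels.Site 3)) x y}).ncard : ℝ)}

/-- item stmt-CriticalPhenomena-18905 · support · rank 9 · closed · proved by Summit.CriticalPhenomena.PercolationContinuityZ3.Theorems.PercPotemkinWeaverFKGHalfSpaceRigiditySplitGlue.fKGHalfSpaceRigiditySplitGlue_proof @ 7596c2261996 (prover) · by planner
sources: BurtonKeane1989, BollobasRiordan2006, Grimmett1999, Summits/CriticalPhenomena/PercolationContinuityZ3/Cruxes/FKGHalfSpaceRigidity/SplitAssembly.lean
[support] strategist split glue FKGGiantBoxDensity → DenseGiantHalfSpace → FKGHalfSpaceRigidity: by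
contradiction θ = μ(|C(0)|=∞) > 0; Burton–Keane for insertion-tolerant ergodic measures
(ae_numInfiniteClusters_le_one_of_isInsertionTolerantErgodic, tree) + the zero–one law for the
shift-invariant measurable event ∃x |C(x)|=∞ (preimage_relabel_shift_setOf_exists_percolatesAt,
measurableSet_percolatesAt_holds) give a.s. EXACTLY one infinite cluster
(numInfiniteClusters_le_one_iff, mem_exactlyOneInfCluster_iff); X₁ gives dense box pieces w.h.p., X₂
an infinite half-space piece with positive probability, contradicting the last hypothesis of X.
PROVED sorry-free: theorem fkgHalfSpaceRigidity_of_pieces in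
Summits/CriticalPhenomena/PercolationContinuityZ3/Cruxes/FKGHalfSpaceRigidity/SplitAssembly.lean @
3cd7540e2e24 (lean check rc0, 45 tactic lines, axioms propext/Classical.choice/Quot.sound; evidence
on stmt-CriticalPhenomena-4881). A prover lands it as
Theorems/PercPotemkinWeaverFKGHalfSpaceRigiditySplit.lean against the route decls (proof is
name-agnostic; file prepared and attached as evidence). [difficulty: provable-now] -/
@[route_item "route-CriticalPhenomena-PercPotemkinWeaver"]
def FKGHalfSpaceRigiditySplitGlue : Prop :=
  FKGGiantBoxDensity → DenseGiantHalfSpace → FKGHalfSpaceRigidity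

/-- item stmt-CriticalPhenomena-4883 · support · rank 9 · closed · proved by Summit.CriticalPhenomena.PercolationContinuityZ3.Theorems.PercPotemkinWeaverBernoulliSoftPortrait.bernoulliSoftPortrait_proof @ 805df5c8b2fb (operator) · by planner
sources: BarskyGrimmettNewman1991, Grimmett1999, Harris1960, BurtonKeane1989, AizenmanDuminilCopinSidoraviciusCMP2015
[support] Bernoulli bond percolation on ℤ³ at p = p_c satisfies every hypothesis of
FKGHalfSpaceRigidity: IsInsertionTolerantErgodic (lattice support; translation invariance =
bondPercolation_real_preimage_shift; zero–one from ergodic_relabel_shift_bondPercolation; insertion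
tolerance = bondPercolation_pow_mul_real_preimage_openEdges_le with 0 < p_c), deletion tolerance ((1
- p_c)^{|E(Λ_N)|}, p_c < 1: Grimmett1999_criticalProb_pos_lt_one_holds), ergodicity under every
non-zero shift (ergodic_relabel_shift_bondPercolation), automorphism invariance
(BondPercolationSymmetry), positive association (harris_fkg_holds), and a.s. finiteness of all
half-space clusters (BarskyGrimmettNewman1991_Z3_holds at the root of {0 ≤ x_0}; other roots by
Harris + insertion of a path; other half-spaces by coordinate symmetries and translations;
induced-graph vs openConnIn bridge as in ConstrainedClusters.lean). Provable now, ~400–700 lines.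
[difficulty: provable-now] -/
@[route_item "route-CriticalPhenomena-PercPotemkinWeaver"]
def BernoulliSoftPortrait : Prop :=
  (∀ᵐ ω ∂(Literature.Probability.Percolation.bondPercolation (Literature.Probability.LatticeModels.zdGraph 3) (Literature.Probability.Percolation.criticalProbI 3)), ω ⊆ (Literature.Probability.LatticeModels.zdGraph 3).edgeSet) ∧ (∀ (v : Literature.Probability.LatticeModels.Site 3) (S : Set (Literature.Probability.Percolation.BondConfig (Literature.Probability.LatticeModels.Site 3))), MeasurableSet S → (Literature.Probability.Percolation.bondPercolation (Literature.Probability.LatticeModels.zdGraph 3) (Literature.Probability.Percolation.criticalProbI 3)) (Literature.Probability.Percolation.BondConfig.relabel (Literature.Probability.Percolation.sym2Equiv (Literature.Probability.LatticeModels.Site.shift v)) ⁻¹' S) = (Literature.Probability.Percolation.bondPercolation (Literature.Probability.LatticeModels.zdGraph 3) (Literature.Probability.Percolation.criticalProbI 3)) S) ∧ (∀ S : Set (Literature.Probability.Percolation.BondConfig (Literature.Probability.LatticeModels.Site 3)), MeasurableSet S → (∀ v : Literature.Probability.LatticeModels.Site 3, Literature.Probability.Percolation.BondConfig.relabel (Literature.Probability.Percolation.sym2Equiv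 (Literature.Probability.LatticeModels.Site.shift v)) ⁻¹' S = S) → (Literature.Probability.Percolation.bondPercolation (Literature.Probability.LatticeModels.zdGraph 3) (Literature.Probability.Percolation.criticalProbI 3)) S = 0 ∨ (Literature.Probability.Percolation.bondPercolation (Literature.Probability.LatticeModels.zdGraph 3) (Literature.Probability.Percolation.criticalProbI 3)) S = 1) ∧ (∀ N : ℕ, ∃ c : ℝ, 0 < c ∧ ∀ S : Set (Literature.Probability.Percolation.BondConfig (Literature.Probability.LatticeModels.Site 3)), MeasurableSet S → c * (Literature.Probability.Percolation.bondPercolation (Literature.Probability.LatticeModels.zdGraph 3) (Literature.Probability.Percolation.criticalProbI 3)).real ((fun ω : Literature.Probability.Percolation.BondConfig (Literature.Probability.LatticeModels.Site 3) => ω ∪ ↑(Literature.Probability.LatticeModels.edgesIn (Literature.Probability.LatticeModels.zdGraph 3) (Literature.Probability.LatticeModels.box 3 N))) ⁻¹' S) ≤ (Literature.Probability.Percolation.bondPercolation (Literature.Probability.LatticeModels.zdGraph 3) (Literature.Probability.Percolation.criticalProbI 3)).real S) ∧ (∀ N : ℕ, ∃ c : ℝ, 0 < c ∧ ∀ S :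 Set (Literature.Probability.Percolation.BondConfig (Literature.Probability.LatticeModels.Site 3)), MeasurableSet S → c * (Literature.Probability.Percolation.bondPercolation (Literature.Probability.LatticeModels.zdGraph 3) (Literature.Probability.Percolation.criticalProbI 3)).real ((fun ω : Literature.Probability.Percolation.BondConfig (Literature.Probability.LatticeModels.Site 3) => ω \ ↑(Literature.Probability.LatticeModels.edgesIn (Literature.Probability.LatticeModels.zdGraph 3) (Literature.Probability.LatticeModels.box 3 N))) ⁻¹' S) ≤ (Literature.Probability.Percolation.bondPercolation (Literature.Probability.LatticeModels.zdGraph 3) (Literature.Probability.Percolation.criticalProbI 3)).real S) ∧ (∀ v : Literature.Probability.LatticeModels.Site 3, v ≠ 0 → Ergodic (Literature.Probability.Percolation.BondConfig.relabel (Literature.Probability.Percolation.sym2Equiv (Literature.Probability.LatticeModels.Site.shift v))) (Literature.Probability.Percolation.bondPercolation (Literature.Probability.LatticeModels.zdGraph 3) (Literature.Probability.Percolation.criticalProbI 3))) ∧ (∀ (γ : Literature.Probability.LatticeModels.zdGraph 3 ≃g Literature.Probability.LatticeModels.zdGraph 3) (A : Set (Literature.Probability.Percolation.BondConfig (Literature.Probability.LatticeModels.Site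 3))), MeasurableSet A → (Literature.Probability.Percolation.bondPercolation (Literature.Probability.LatticeModels.zdGraph 3) (Literature.Probability.Percolation.criticalProbI 3)) (Literature.Probability.Percolation.BondConfig.relabel (Literature.Probability.Percolation.sym2Equiv γ.toEquiv) ⁻¹' A) = (Literature.Probability.Percolation.bondPercolation (Literature.Probability.LatticeModels.zdGraph 3) (Literature.Probability.Percolation.criticalProbI 3)) A) ∧ (∀ A B : Set (Literature.Probability.Percolation.BondConfig (Literature.Probability.LatticeModels.Site 3)), IsUpperSet A → IsUpperSet B → MeasurableSet A → MeasurableSet B → (Literature.Probability.Percolation.bondPercolation (Literature.Probability.LatticeModels.zdGraph 3) (Literature.Probability.Percolation.criticalProbI 3)) A * (Literature.Probability.Percolation.bondPercolation (Literature.Probability.LatticeModels.zdGraph 3) (Literature.Probability.Percolation.criticalProbI 3)) B ≤ (Literature.Probability.Percolation.bondPercolation (Literature.Probability.LatticeModels.zdGraph 3) (Literature.Probability.Percolation.criticalProbI 3)) (A ∩ B)) ∧ (∀ᵐ ω ∂(Literature.Probability.Percolation.bondPercolation (Literature.Probability.LatticeModels.zdGraph 3) (Literature.Probability.Percolation.criticalProbI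 3)), ∀ (i : Fin 3) (a : ℤ) (v : Literature.Probability.LatticeModels.Site 3), {y : Literature.Probability.LatticeModels.Site 3 | ω ∈ Literature.Probability.Percolation.openConnIn {x : Literature.Probability.LatticeModels.Site 3 | a ≤ x i} v y}.Finite ∧ {y : Literature.Probability.LatticeModels.Site 3 | ω ∈ Literature.Probability.Percolation.openConnIn {x : Literature.Probability.LatticeModels.Site 3 | x i ≤ a} v y}.Finite)

/-- item stmt-CriticalPhenomena-4884 · assembly · rank 1 · closed · proved by Summit.CriticalPhenomena.PercolationContinuityZ3.Theorems.PercPotemkinWeaverAssembly.assembly_proof @ 6aa50cc13111 (prover) · by planner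
sources: Grimmett1999, BarskyGrimmettNewman1991
[assembly] BernoulliSoftPortrait → FKGHalfSpaceRigidity → PercolationContinuityZ3 (θ(p_c) =
P_{p_c}(|C(0)| = ∞) = 0 by instantiating X at μ = P_{p_c}). -/
@[route_item "route-CriticalPhenomena-PercPotemkinWeaver"]
def Assembly : Prop :=
  BernoulliSoftPortrait → FKGHalfSpaceRigidity → PercolationContinuityZ3

/-! D-0027 §2.1 — DECIDING THEOREM (planner-authored via `route open/edit --closes-file`; by planner-cstrat-stmt-CriticalPhenomena-4881-r1-0 2026-08-17T03:11:14Z):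
its hypotheses are this route's items and its conclusion the sub-problem Statement (glue_lint), and it elaborates with this file. -/

/-- D-0027 §2.1 deciding theorem of route PercPotemkinWeaver after the strategist split of the
thesis X = `FKGHalfSpaceRigidity` (2026-08-17): X is DERIVED from its two pieces
`FKGGiantBoxDensity` (X₁: FKG giants are monolithic) and `DenseGiantHalfSpace` (X₂: monolithic FKG
giants percolate in half-spaces) through the glue item `FKGHalfSpaceRigiditySplitGlue`
(X₁ → X₂ → X, proved sorry-free in Cruxes/FKGHalfSpaceRigidity/SplitAssembly.lean: Burton–Keane +
zero–one law), and then instantiated at `μ = P_{p_c}` on `ℤ³`, whose nine hypotheses are exactly the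
nine conjuncts of `BernoulliSoftPortrait`; `θ(p_c) = (P_{p_c}(|C(0)| = ∞)).toReal = 0`. Pure logic. -/
@[closes "route-CriticalPhenomena-PercPotemkinWeaver"] theorem closes (h₁ : BernoulliSoftPortrait) (h₂ : FKGGiantBoxDensity) (h₃ : DenseGiantHalfSpace)
    (hG : FKGHalfSpaceRigiditySplitGlue) : PercolationContinuityZ3 := by
  obtain ⟨hsupp, hshift, htriv, hins, hdel, herg, haut, hfkg, hhalf⟩ := h₁
  have hμ := hG h₂ h₃ (Literature.Probability.Percolation.bondPercolation
      (Literature.Probability.LatticeModels.zdGraph 3) (Literature.Probability.Percolation.criticalProbI 3))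
    inferInstance hsupp hshift htriv hins hdel herg haut hfkg hhalf
  show Literature.Probability.Percolation.theta _ _ _ = 0
  rw [Literature.Probability.Percolation.theta, MeasureTheory.measureReal_def, hμ, ENNReal.toReal_zero]

end Summit.CriticalPhenomena.PercolationContinuityZ3.Theses.PercPotemkinWeaver
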